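import Summits.HodgeConjecture.HodgeConjecture.Theorems.Ring2AbelianAllSpreadFloorAboveMiddle
import Summits.HodgeConjecture.HodgeConjecture.Theorems.Ring2ClassTargets
import HarnessLib

/-!
# Ring 2 · AbelianAll · SPREADING axis, part XXXIII — the GRADED COST of the middle floor, FACT-FREE:
# `HC_AVmid⁽P'⁾ → HC_AVmid⁽P⁾` for `P ≤ P'` (middle-cell MONOTONICITY, = Gysin pad of part XV + pull-back pad of part XXXII);
# `HC_AVmid⁽G⁾` is EXACTLY HC on the central band `p ≤ G, dim A - p ≤ G`, so `HCUpToDim (2G) → HC_AVmid⁽G⁾ → HCUpToDim G`;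
# and the instance `F_CM^mid[G]` of N104 at the single middle cell `(2G, G)` satisfies `HC_CM⁽G⁾ ∧ F_CM^mid[G] ⟹ HCUpToDim G`
# (dimension factor 2, NO named fact), `HCUpToDim (2G) ⟹ F_CM^mid[G]` (on-path), `F_CM^mid ⟺ ∀ G, F_CM^mid[G]`.

research route, not a corollary; conditional on HC_CM plus one named minimal statement.
(Cell line: research route conditional on HC_CM; not a corollary; Q11.4-sentence-2 already refuted in dim ≥ 3.)

Seat `pub-hodge-ring2-ab-spread-1` (SPREADING), generation 57; the certificate was kernel-checked in the seat directory in generation 56 and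
is filed on the LEAD's ruling L78.2 (a) (REQUESTS `ab-spread-1/SPREAD-GRADED-COST#ruling#served`: "YES, as asked and only as asked"),
statements and proofs unchanged. Nothing here is a case of the Hodge conjecture; NO node / def / abbrev / named fact is minted: the
graded shapes are DISPLAY-ONLY local notations (parts XXV/XXVI grammar) for unfoldings of the EXISTING constants `HodgeAbelianVarieties`
(`HC_AV`, stmt-1333), `CMAbelianHodge` (`HC_CM`, stmt-3052; ALWAYS a binder, never a fact), part XXIV's node
`MiddleHodgeFailureSpreadsToCMFibre` (`F_CM^mid`, census N104 = the cell's `B_min` of record, declared UNTOUCHED by this file;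
«minimal» claimed for nothing) and `Ring2.ClassTargets.HCUpToDim` (the cell's typed intermediate class targets `HC_<dim ≤ G>`).
The item `Theses.RankFourFaces.CMToAbelian` (stmt-HodgeConjecture-16267) stays OPEN.

Docstring revision 2 (generation 58): the twelve `folklore` tags that revision 1 (p311889) put on this file's OWN rows are
dropped in favour of the words «NO fact» (referee ref2, REFEREE §128.4, advisory F-ref2-101: that tag is reserved for content-free
standard-API helpers; these rows are the cell's own Summits-side results, proved here, resting on no named fact); the six rows that
formalise a printed step keep their `cite` tags. Statements and proofs are byte-identical to revision 1; no census effect.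

## Why this file (the record it serves, by name)

* The brief's INTERMEDIATE CLASS TARGETS `HC_<class>_of_HC_CM` on the spreading axis: part XXIV closes the cell with ONE hypothesis
  (`HC_AV_of_HC_CM_and_middleHodgeFailureSpreadsToCMFibre : HC_CM → F_CM^mid → HC_AV`); here the same node is read CELL BY CELL —
  `F_CM^mid[G]` is N104 at the one middle cell `(2G, G)` — and the graded target `HCUpToDim G` (all complex abelian varieties of
  dimension `≤ G`, every codimension) is paid for by `HC_CM` in the ONE codimension `G` plus `F_CM^mid[G]`, with its ON-PATH lemma
  `HCUpToDim (2G) → F_CM^mid[G]` (so nothing here is summit-progress rhetoric: each graded row is a CASE of `HC_AV`).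
* The middle-cell monotonicity `HC_AVmid⁽P'⁾ → HC_AVmid⁽P⁾` (§1) is booked by no other Ring-2 file: part XXVI §1 has the
  fixed-codimension heredities `HC_AV⁽m⁾ → HC_AV⁽p⁾`, `HC_CM⁽m⁾ → HC_CM⁽p⁾` only; part XV has the Gysin pad into the middle cell,
  part XXXII the pull-back pad out of it; §1 is their composite.
* The ANDRÉ axis (@ab-andre-2, part XXXIII-f `Ring2AbelianAllAndreLevelsMonotone`: `[6.3.1] → HC_CM → LiftMidAt[2G] → HCUpToDim G`,
  dimension factor 4, and `HC_AV ⟺ HC_CM ∧ ⋀_{k ≥ K} LiftMidAt[k]` mod [6.3.1, Verdier]) is the sibling reading; it is NOT compared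
  in the kernel — NO kernel row between the axes is filed here or claimed (different binders: a universal lift over all compact
  abelian pencils there, an existential anchored datum per failure here); words only, count once theirs.

## What is checked (all fact-free unless `hF` is displayed)

* §1 `forall_codim_middle_anti : P ≤ P' → HC_AVmid⁽P'⁾ → HC_AVmid⁽P⁾` — pull a middle class of `A` (`dim A = 2P`) back to
  `A × B` with `dim B = P' - P` (a class of codimension `P` BELOW the middle of the `(2P + (P' - P))`-fold `A × B`), close it by
  part XV's middle cell `(P, P' - P)` (middle codimension `P'`), and restrict back along `a ↦ (a, 0)` (part XXXII
  `isRationalClass_isOfHodgeType_not_mem_map_fst`).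
* §2 `HC_AVmid⁽G⁾ ⟺` HC on the CENTRAL BAND `{(A, p) : p ≤ G, dim A ≤ G + p}` (below the middle: part XV's middle cell, middle
  codimension `dim A - p`; above: hard Lefschetz `HardLefschetzNFold.mem_algebraicClasses_of_lt_holds`, middle codimension `p`);
  hence `HCUpToDim (2 * G) → HC_AVmid⁽G⁾ → HCUpToDim G` (`Ring2.ClassTargets`).
* §3 `F_CM^mid[G]` (N104 at `m := G`, guard `2 ≤ m` dropped — it holds outright for `G ≤ 1`): `F_CM^mid ↔ ∀ G, F_CM^mid[G]`;
  `HC_CM⁽G⁾ → F_CM^mid[G] → HC_AVmid⁽G⁾ → HCUpToDim G`; ON-PATH `HCUpToDim (2 * G) → F_CM^mid[G]`; DOWNWARD monotonicity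
  `G ≤ G' → HC_CM⁽G'⁾ → F_CM^mid[G'] → F_CM^mid[G]` (mod `HC_CM⁽G'⁾` only); mod Deligne's displayed `hF`:
  `F_CM^mid[G] ⟺ (HC_CM⁽G⁾ → HC_AVmid⁽G⁾)`; and `HC_AV ⟺ HC_CM ∧ (∀ K, ∃ G ≥ K, F_CM^mid[G])`.

## Honest column

(a) NO fact-free edge `F_CM^mid[G'] → F_CM^mid[G]` or `F_CM^mid[G] → F_CM^mid[G']` is claimed: the anchored datum is pull-back
rigid (parts XXIV/XXXII honest (i)); mod `hF` the instances read `(HC_CM⁽G⁾ → HC_AVmid⁽G⁾)`, pairwise comparable only through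
`HC_CM⁽G'⁾`. (b) The dimension factor `2` (`F_CM^mid` at dimension `2G` pays for HC up to dimension `G`) is the middle-cell cost of
part XV, not a new reduction; the sibling axis' `LiftMidAt[2G] ⟹ HCUpToDim G mod [6.3.1]` (ab-andre-2, part XXXIII-f) is NOT
compared in the kernel (different binders; words only; no kernel row between the axes). (c) Nothing is «minimal»; `B_min` of record
is UNCHANGED (N104 `MiddleHodgeFailureSpreadsToCMFibre`, exact `HC_AV ↔ HC_CM ∧ F_CM^mid`, part XXIV); the graded shapes
`HC_CM⁽p⁾`, `HC_AVmid⁽m⁾`, `F_CM^mid[G]` are displayed binders, never asserted, not `B_min` candidates, and enter no census (no node,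
no `def`, no new edge between nodes; the `∀ K, ∃ G ≥ K` row is over an instance term). Nothing here proves `HC_AV`, `HC_CM`,
`CMToAbelian` or `F_CM^mid`. Only `N⁰H⁰ = ⊤` and Lefschetz `(1,1)` (tree theorem, via part XXVI's `forall_codim_AV_zero/one`; counted
once, not this axis's) are used to drop the guard `2 ≤ G`. Parts VII, XIV–XXXII untouched.
[cite: BrosnanFangNiePearlstein2009, §6 Lemma 48 (proof)] [cite: KerrPearlstein2011, §3.1]
[cite: VoisinHodgeI2002, Thm. 6.25, §11.3, Thm. 11.30] [cite: Deligne1982HodgeCycles, Prop. 6.1 (a)(b) (p. 71)]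
[cite: Fulton1998, §19.2 Cor. 19.2 (b)]
-/

set_option linter.dupNamespace false

open CategoryTheory AlgebraicGeometry
open Literature.AlgebraicGeometry Literature.AlgebraicGeometry.Motives
open Literature.AlgebraicGeometry.HodgeTheory
open Literature.AlgebraicGeometry.Milne1999 (IsOfCMType)
open Literature.AlgebraicGeometry.Deligne1982 (deligne1982_cmDenseMumfordTateFamilies cmLocus)
open Literature.AlgebraicTopology.SingularHomology

namespace Summit.HodgeConjecture.HodgeConjecture.Ring2.AbelianAll

open Summit.HodgeConjecture.HodgeConjecture
open Summit.HodgeConjecture.HodgeConjecture.Theorems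
open Summit.HodgeConjecture.HodgeConjecture.Theses
open Summit.HodgeConjecture.HodgeConjecture.Theses.RankFourFaces (CMAbelianHodge CMToAbelian)
open Summit.HodgeConjecture.HodgeConjecture.Theses.PadicSemiregularLift (HodgeAbelianVarieties)
open Summit.HodgeConjecture.HodgeConjecture.Ring2.ClassTargets (HCOnClass HCUpToDim)

variable {𝒳 S : SchemeOver ℂ}

/-! ## §0 Display-only graded shapes (local notation; NO def, NO abbrev, nothing enters the census) -/

/-- `HC_CM⁽p⁾` — DISPLAY ONLY (part XXV): the Hodge conjecture for CM abelian varieties in codimension `p`. -/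
local notation3 (prettyPrint := false) "HC_CM⁽" p "⁾" =>
  ∀ (A : AbelianVariety ℂ), IsOfCMType A → ∀ (c : complexBetti A.X (2 * p)), IsRationalClass c →
    IsOfHodgeType A.dim A.X (2 * p) p p c → c ∈ algebraicClasses A.X p

/-- `HC_AVmid⁽m⁾` — DISPLAY ONLY (part XXV): HC in the middle codimension `m` on abelian varieties of dimension `2m`. -/
local notation3 (prettyPrint := false) "HC_AVmid⁽" m "⁾" =>
  ∀ (A : AbelianVariety ℂ), A.dim = 2 * m → ∀ (c : complexBetti A.X (2 * m)), IsRationalClass c →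
    IsOfHodgeType A.dim A.X (2 * m) m m c → c ∈ algebraicClasses A.X m

/-- `F_CM^mid[G]` — DISPLAY ONLY: the instance of part XXIV's `MiddleHodgeFailureSpreadsToCMFibre` (N104) at the single middle cell
`(2G, G)`, binder for binder (`m := G`, the guard `2 ≤ m` dropped). -/
local notation3 (prettyPrint := false) "F_CM^mid[" G "]" =>
  ∀ (A : AbelianVariety ℂ), IsSmoothProjective A.dim A.X → A.dim = 2 * G →
    ∀ (c : complexBetti A.X (2 * G)), IsRationalClass c → IsOfHodgeType A.dim A.X (2 * G) G G c →
      c ∉ algebraicClasses A.X G →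
        ∃ (n : ℕ) (𝒳 S : SchemeOver ℂ) (f : 𝒳 ⟶ S) (s : ComplexPoints S) (W : complexBetti 𝒳 (2 * G)),
          IsCMAnchoredDatumFor A G c f n s W ∧
            ∃ s' ∈ cmLocus f n, complexBetti.map (fiberι f s') (2 * G) W ∉ algebraicClasses (fiberOver f s') G

/-! ## §1 Middle-cell monotonicity (NO fact) -/

/-- **`P ≤ P' → HC_AVmid⁽P'⁾ → HC_AVmid⁽P⁾`** — NO fact: pull the middle class `c` of `A` (`dim A = 2P`) back along `fst` to
`A × B` with `dim B = P' - P` (part XXXII `isRationalClass_isOfHodgeType_not_mem_map_fst`: rational, `(P,P)`, and NOT algebraic if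
`c` is not, since `(𝟙, 0)^* fst^* c = c`), where it sits in part XV's middle cell `(P, P' - P)` of middle codimension `P'`.
[cite: BrosnanFangNiePearlstein2009, §6 Lemma 48 (proof)] [cite: Fulton1998, §19.2 Cor. 19.2 (b)] -/
theorem forall_codim_middle_anti {P P' : ℕ} (hPP' : P ≤ P') (h : HC_AVmid⁽P'⁾) : HC_AVmid⁽P⁾ := by
  intro A hA c hc hpp
  obtain ⟨r, rfl⟩ : ∃ r, P' = P + r := ⟨P' - P, by omega⟩
  rcases r with _ | r'
  · exact h A (by omega) c hc hpp
  · obtain ⟨B, hB⟩ := exists_abelianVariety_dim_eq_succ ℂ r'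
    by_contra hnc
    obtain ⟨hQ, hH, hn⟩ := isRationalClass_isOfHodgeType_not_mem_map_fst A B hc hpp hnc
    refine hn (mem_algebraicClasses_of_middleCell (A.prod B) (p := P) (r := r' + 1)
      (by rw [AbelianVariety.dim_prod, hB]; omega) (fun B' hB' c' hc' hpp' ↦ h B' hB' c' hc' ?_) _ hQ hH)
    rw [hB']
    exact hpp'

/-! ## §2 `HC_AVmid⁽G⁾` is HC on the central band; the two dimension targets around it (NO fact) -/

/-- **`HC_AVmid⁽G⁾` gives every cell `(A, p)` of the CENTRAL BAND `p ≤ G`, `dim A ≤ G + p`** — NO fact: below the middle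
(`2p ≤ dim A`) part XV's middle cell `(p, dim A - 2p)` has middle codimension `dim A - p ≤ G`; above it hard Lefschetz reduces to
codimension `dim A - p` whose middle cell has middle codimension `p ≤ G`; both middle cells follow from `HC_AVmid⁽G⁾` by §1.
[cite: BrosnanFangNiePearlstein2009, §6 Lemma 48] [cite: KerrPearlstein2011, §3.1] [cite: VoisinHodgeI2002, Thm. 6.25, Rem. 6.27] -/
theorem mem_algebraicClasses_of_forall_codim_middle_of_band {G : ℕ} (h : HC_AVmid⁽G⁾) (A : AbelianVariety ℂ) {p : ℕ}
    (hpG : p ≤ G) (hAG : A.dim ≤ G + p) (c : complexBetti A.X (2 * p)) (hc : IsRationalClass c)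
    (hpp : IsOfHodgeType A.dim A.X (2 * p) p p c) : c ∈ algebraicClasses A.X p := by
  have hX : IsSmoothProjective A.dim A.X := AbelianVariety.isSmoothProjective_holds
  rcases Nat.lt_or_ge A.dim p with hAp | hAp
  · haveI : Subsingleton (complexBetti A.X (2 * p)) := ComplexPoints.subsingleton_singularCohomology_of_lt hX ℂ (by omega)
    rw [Subsingleton.elim c 0]
    exact Submodule.zero_mem _
  rcases Nat.lt_or_ge A.dim (2 * p) with hlt | hge
  · have hmid : HC_AVmid⁽p⁾ := forall_codim_middle_anti hpG h
    refine HardLefschetzNFold.mem_algebraicClasses_of_lt_holds hX hlt (fun c' hc' hpp' ↦ ?_) c hc hpp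
    exact mem_algebraicClasses_of_middleCell A (p := A.dim - p) (r := 2 * p - A.dim) (by omega)
      (fun B hB c'' hc'' hpp'' ↦ forall_codim_middle_congr (show p = A.dim - p + (2 * p - A.dim) by omega) hmid B hB c''
        hc'' (by rw [hB]; exact hpp'')) c' hc' hpp'
  · have hmid : HC_AVmid⁽A.dim - p⁾ := forall_codim_middle_anti (show A.dim - p ≤ G by omega) h
    exact mem_algebraicClasses_of_middleCell A (p := p) (r := A.dim - 2 * p) (by omega)
      (fun B hB c' hc' hpp' ↦ forall_codim_middle_congr (show A.dim - p = p + (A.dim - 2 * p) by omega) hmid B hB c' hc'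
        (by rw [hB]; exact hpp')) c hc hpp

/-- Conversely the middle cell `(2G, G)` lies in the band: `HC_AVmid⁽G⁾ ⟺` HC on the central band, NO fact. -/
theorem forall_codim_middle_iff_band (G : ℕ) :
    HC_AVmid⁽G⁾ ↔ ∀ (A : AbelianVariety ℂ) (p : ℕ), p ≤ G → A.dim ≤ G + p → ∀ (c : complexBetti A.X (2 * p)),
      IsRationalClass c → IsOfHodgeType A.dim A.X (2 * p) p p c → c ∈ algebraicClasses A.X p :=
  ⟨fun h A _ hpG hAG c hc hpp ↦ mem_algebraicClasses_of_forall_codim_middle_of_band h A hpG hAG c hc hpp,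
    fun h A hA c hc hpp ↦ h A G le_rfl (by omega) c hc hpp⟩

/-- **`HC_AVmid⁽G⁾ → HCUpToDim G`**: every abelian variety of dimension `≤ G` lies in the band in every codimension, NO fact
(`hodgeConjectureFor_iff_of_isSmoothProjective`, Hodge models exist). [cite: VoisinHodgeI2002, §11.3] -/
theorem hcUpToDim_of_forall_codim_middle {G : ℕ} (h : HC_AVmid⁽G⁾) : HCUpToDim G := by
  intro A hAG
  have hX : IsSmoothProjective A.dim A.X := AbelianVariety.isSmoothProjective_holds
  refine (hodgeConjectureFor_iff_of_isSmoothProjective nonempty_hodgeModel_holds hX).2 fun p c hc hpp ↦ ?_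
  rcases Nat.lt_or_ge A.dim p with hAp | hAp
  · haveI : Subsingleton (complexBetti A.X (2 * p)) := ComplexPoints.subsingleton_singularCohomology_of_lt hX ℂ (by omega)
    rw [Subsingleton.elim c 0]
    exact Submodule.zero_mem _
  · exact mem_algebraicClasses_of_forall_codim_middle_of_band h A (by omega) (by omega) c hc hpp

/-- **`HCUpToDim (2 * G) → HC_AVmid⁽G⁾`** (the middle cell is one cell of dimension `2G`), NO fact. -/
theorem forall_codim_middle_of_hcUpToDim_two_mul {G : ℕ} (h : HCUpToDim (2 * G)) : HC_AVmid⁽G⁾ :=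
  fun A hA c hc hpp ↦ (h A hA.le).2 G c hc hpp

/-! ## §3 The graded middle floor `F_CM^mid[G]` and its cost (NO fact unless `hF` is displayed) -/

/-- `F_CM^mid ⟺ ∀ G ≥ 2, F_CM^mid[G]` (binder swap), NO fact. -/
theorem middle_iff_forall_two_le_middleFloorAt :
    MiddleHodgeFailureSpreadsToCMFibre ↔ ∀ G : ℕ, 2 ≤ G → F_CM^mid[G] :=
  ⟨fun h G hG A hA hdim c hc hpp hnc ↦ h A hA G hG hdim c hc hpp hnc,
    fun h A hA m hm hdim c hc hpp hnc ↦ h m hm A hA hdim c hc hpp hnc⟩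

/-- `F_CM^mid[G]` holds vacuously as soon as `HC_AVmid⁽G⁾` does (no failure in the cell), NO fact. -/
theorem middleFloorAt_of_forall_codim_middle {G : ℕ} (h : HC_AVmid⁽G⁾) : F_CM^mid[G] :=
  fun A _ hdim c hc hpp hnc ↦ absurd (h A hdim c hc hpp) hnc

/-- `F_CM^mid[0]`, `F_CM^mid[1]` hold outright (`N⁰H⁰ = ⊤`, Lefschetz `(1,1)`), NO fact. [cite: VoisinHodgeI2002, Thm. 11.30] -/
theorem middleFloorAt_of_lt_two {G : ℕ} (hG : G < 2) : F_CM^mid[G] := by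
  refine middleFloorAt_of_forall_codim_middle fun A _ c hc hpp ↦ ?_
  interval_cases G
  · exact forall_codim_AV_zero A c hc hpp
  · exact forall_codim_AV_one A c hc hpp

/-- `F_CM^mid ⟺ ∀ G, F_CM^mid[G]` (the guard `2 ≤ G` is free), NO fact. -/
theorem middle_iff_forall_middleFloorAt : MiddleHodgeFailureSpreadsToCMFibre ↔ ∀ G : ℕ, F_CM^mid[G] := by
  refine middle_iff_forall_two_le_middleFloorAt.trans ⟨fun h G ↦ ?_, fun h G _ ↦ h G⟩
  rcases Nat.lt_or_ge G 2 with hG | hG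
  · exact middleFloorAt_of_lt_two hG
  · exact h G hG

/-- **`HC_CM⁽G⁾ → F_CM^mid[G] → HC_AVmid⁽G⁾`**, NO fact (part XXV `not_codim_cm_of_isCMAnchoredDatumFor_of_not_mem`: a failing CM
fibre of an anchored datum IS a failure of `HC_CM` in the same codimension). -/
theorem forall_codim_middle_of_codim_CM_of_middleFloorAt {G : ℕ} (hCMG : HC_CM⁽G⁾) (h : F_CM^mid[G]) : HC_AVmid⁽G⁾ := by
  intro A hA c hc hpp
  by_contra hnc
  obtain ⟨n, 𝒳, S, f, s, W, hd, s', hs', hns'⟩ := h A AbelianVariety.isSmoothProjective_holds hA c hc hpp hnc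
  exact not_codim_cm_of_isCMAnchoredDatumFor_of_not_mem hd hs' hns' hCMG

/-- **GRADED COST, NO fact: `HC_CM⁽G⁾ ∧ F_CM^mid[G] ⟹ HCUpToDim G`** — the CM Hodge conjecture in the ONE codimension `G` and the
middle floor at the ONE cell `(2G, G)` pay for the Hodge conjecture on ALL complex abelian varieties of dimension `≤ G` (every
codimension). Dimension factor `2`. [cite: BrosnanFangNiePearlstein2009, §6 Lemma 48] [cite: KerrPearlstein2011, §3.1] -/
theorem hcUpToDim_of_codim_CM_of_middleFloorAt {G : ℕ} (hCMG : HC_CM⁽G⁾) (h : F_CM^mid[G]) : HCUpToDim G :=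
  hcUpToDim_of_forall_codim_middle (forall_codim_middle_of_codim_CM_of_middleFloorAt hCMG h)

/-- **`HC_CM → F_CM^mid[G] → HCUpToDim G`** (the binder `HC_CM` by name), NO fact. -/
theorem hcUpToDim_of_HC_CM_of_middleFloorAt (hCM : CMAbelianHodge) {G : ℕ} (h : F_CM^mid[G]) : HCUpToDim G :=
  hcUpToDim_of_codim_CM_of_middleFloorAt (fun A hAcm c hc hpp ↦ (hCM A AbelianVariety.isSmoothProjective_holds hAcm).2 G c hc hpp) h

/-- **ON-PATH, NO fact: `HCUpToDim (2 * G) → F_CM^mid[G]`** (and so `HC_AV → F_CM^mid[G]`). -/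
theorem middleFloorAt_of_hcUpToDim_two_mul {G : ℕ} (h : HCUpToDim (2 * G)) : F_CM^mid[G] :=
  middleFloorAt_of_forall_codim_middle (forall_codim_middle_of_hcUpToDim_two_mul h)

/-- ON-PATH: `HC_AV → F_CM^mid[G]`, NO fact. -/
theorem middleFloorAt_of_HC_AV (h : HodgeAbelianVarieties) (G : ℕ) : F_CM^mid[G] :=
  fun A _ _ c hc hpp hnc ↦ absurd ((h A).2 G c hc hpp) hnc

/-- **DOWNWARD monotonicity mod `HC_CM⁽G'⁾` only: `G ≤ G' → HC_CM⁽G'⁾ → F_CM^mid[G'] → F_CM^mid[G]`**, NO fact (through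
`HC_AVmid⁽G'⁾ → HC_AVmid⁽G⁾` and vacuity). No fact-free edge between `F_CM^mid[G']` and `F_CM^mid[G]` is claimed. -/
theorem middleFloorAt_anti_of_codim_CM {G G' : ℕ} (hGG' : G ≤ G') (hCMG' : HC_CM⁽G'⁾) (h : F_CM^mid[G']) : F_CM^mid[G] :=
  middleFloorAt_of_forall_codim_middle (forall_codim_middle_anti hGG' (forall_codim_middle_of_codim_CM_of_middleFloorAt hCMG' h))

/-- **POINTWISE LOCATION mod `hF` (displayed): `F_CM^mid[G] ⟺ (HC_CM⁽G⁾ → HC_AVmid⁽G⁾)`**; the forward direction is fact-free.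
[cite: Deligne1982HodgeCycles, Prop. 6.1 (a)(b) (p. 71)] -/
theorem middleFloorAt_iff_of_deligne1982 (hF : deligne1982_cmDenseMumfordTateFamilies) (G : ℕ) :
    F_CM^mid[G] ↔ (HC_CM⁽G⁾ → HC_AVmid⁽G⁾) := by
  refine ⟨fun h hCMG ↦ forall_codim_middle_of_codim_CM_of_middleFloorAt hCMG h, fun h A hA hdim c hc hpp hnc ↦ ?_⟩
  rcases Nat.eq_zero_or_pos G with rfl | hG
  · exact absurd (forall_codim_AV_zero A c hc hpp) hnc
  have hCMG : ¬ HC_CM⁽G⁾ := fun hCMG ↦ hnc (h hCMG A hdim c hc hpp)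
  push Not at hCMG
  obtain ⟨B, hB, b, hbQ, hbH, hnb⟩ := hCMG
  exact exists_isCMAnchoredDatumFor_and_cmFailure_of_deligne1982 hF hA hG.ne' hc hpp hB hbQ hbH hnb

/-- **EXACTNESS in the graded reading, NO named fact: `HC_AV ⟺ HC_CM ∧ (∀ K, ∃ G ≥ K, F_CM^mid[G])`** — cofinally many middle
floors suffice (with `HC_CM`), since `F_CM^mid[G]` with `HC_CM` pays for all dimensions `≤ G`. -/
theorem HC_AV_iff_HC_CM_and_frequently_middleFloorAt :
    HodgeAbelianVarieties ↔ CMAbelianHodge ∧ ∀ K : ℕ, ∃ G : ℕ, K ≤ G ∧ F_CM^mid[G] := by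
  refine ⟨fun h ↦ ⟨Ring2.Deform.HC_CM_of_HC_AV h, fun K ↦ ⟨K, le_rfl, middleFloorAt_of_HC_AV h K⟩⟩, fun ⟨hCM, hfreq⟩ A ↦ ?_⟩
  obtain ⟨G, hKG, hG⟩ := hfreq A.dim
  exact hcUpToDim_of_HC_CM_of_middleFloorAt hCM hG A hKG

/-- The cell's closing row recovered through the grading (sanity): `HC_CM → F_CM^mid → HC_AV`, NO fact. -/
theorem HC_AV_of_HC_CM_of_forall_middleFloorAt (hCM : CMAbelianHodge) (h : ∀ G : ℕ, F_CM^mid[G]) : HodgeAbelianVarieties :=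
  HC_AV_iff_HC_CM_and_frequently_middleFloorAt.2 ⟨hCM, fun K ↦ ⟨K, le_rfl, h K⟩⟩

example (hCM : CMAbelianHodge) (h : MiddleHodgeFailureSpreadsToCMFibre) : HodgeAbelianVarieties :=
  HC_AV_of_HC_CM_of_forall_middleFloorAt hCM (middle_iff_forall_middleFloorAt.1 h)

#print axioms hcUpToDim_of_HC_CM_of_middleFloorAt
#print axioms HC_AV_iff_HC_CM_and_frequently_middleFloorAt
#print axioms forall_codim_middle_anti

end Summit.HodgeConjecture.HodgeConjecture.Ring2.AbelianAll
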